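import Literature.Topology.FourManifolds.TautFoliations
import HarnessLib

/-!
# Plaques and leaf heights of `C⁰` codimension-one foliations

Sibling of `TautFoliations.lean`, which defines `C⁰` codimension-one foliations
(`Literature.Topology.FourManifolds.Foliation`: a foliated atlas of flow boxes `e : M ⊇ e.source ≃ B × ℝ`
whose changes of coordinates locally preserve the plaques `B × {t}`) and their leaves
(`Foliation.leaf x`: the points joined to `x` by a finite chain of plaques). This file develops
the elementary point-set theory of plaques and leaves on which every argument about leaves
rests (Hector–Hirsch, *Introduction to the Geometry of Foliations, Part A*, Ch. I 2.2.2 and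
Ch. II 2.1.6 (iii)–(v): plaques, the leaf topology, leaves; Ch. I 4.1.1–4.1.2: the transverse
structure of a leaf read on transversals), with complete proofs:

* `Foliation.plaque e t` (**definition**): the plaque of the flow box `e` at height `t`, the
  points of `e.source` with transverse coordinate `t`; for a flow box of a foliation it is the
  image `e.symm '' (B × {t})` (`plaque_eq_range`), (pre)connected when `B` is.
* `Foliation.leafHeights F e x` (**definition**): the set `H_e(L)` of heights at which the leaf
  `L = F.leaf x` crosses the flow box `e` — the trace of `L` on the transversals of the box.
  Leaves are *saturated by plaques* (`plaque_subset_leaf`): `L ∩ e.source` is the union of the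
  plaques of `e` at the heights `H_e(L)` (`leaf_inter_source`, `mem_leaf_iff_of_mem_source`),
  and `H_e(L)` is the preimage of `L` under every vertical `t ↦ e.symm (b, t)`
  (`leafHeights_eq_preimage`); hence a *closed leaf has closed height sets*
  (`isClosed_leafHeights`).
* **Transverse coordinates are locally constant along plaques**
  (`exists_nhds_height_eq_of_mem_plaque`, `height_eq_of_isPreconnected`): the defining property
  of a foliated atlas, read on one plaque — the `e'`-height is locally constant on
  `plaque e t ∩ e'.source`, hence constant on its preconnected subsets (Hector–Hirsch A,
  Ch. II 2.1.6 (iii): "the intersection of two plaques is a union of plaques").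
* **Self-accumulation of a leaf is transported along the leaf**
  (`accPt_leafHeights_of_mem_plaque`, `accPt_leafHeights_iff_of_mem_leaf`): if the heights
  `H_e(L)` accumulate at the height of a point `y` of a plaque of `e`, then for every other flow
  box `e'` around `y` the heights `H_{e'}(L)` accumulate at the `e'`-height of `y`; along chains
  of plaques, accumulation at one point of `L` in one flow box forces accumulation at every
  point of `L` in every flow box (Hector–Hirsch A, Ch. I 4.1.1: the local homeomorphisms
  between transversals defined by the foliation along a leaf curve carry `c₀ ∩ L` to `c₁ ∩ L`,
  here in its `C⁰`, chart-wise form). Consequently, where the heights do *not* accumulate, the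
  leaf is *locally a single plaque* (`exists_mem_leaf_iff_of_not_accPt`).

These are the ingredients of "a closed leaf is proper" (Hector–Hirsch A, Ch. I 4.1.2 (i);
sibling file `TautFoliationsClosedLeaves.lean`): together with the countability of `H_e(L)`
(`TautFoliationsLeafHeights.lean`) they show that a closed leaf meets every sufficiently thin
flow box slab around each of its points in exactly one plaque.

## References

* G. Hector, U. Hirsch, *Introduction to the Geometry of Foliations, Part A*, 2nd ed., Vieweg
  (1986), Ch. I 2.2.1, 2.2.2, 4.1.1, 4.1.2; Ch. II 2.1.1, 2.1.6; Ch. III 2.1.2 [HectorHirsch1986].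

## Design notes

* Everything is stated for a general leaf model `B` and a general topological space `M`;
  (pre)connectedness of `B` (plaques connected) and `Nonempty B` are assumed only where used.
  No smoothness and no manifold structure on `M` are involved.
* Accumulation of heights is phrased with Mathlib's `AccPt t (𝓟 H)` ("`t` is an accumulation
  point of the set `H`"), so that "every height accumulates" is `Preperfect H` and the perfect
  set theorem applies verbatim in `TautFoliationsClosedLeaves.lean`.
* Nothing here is specific to 3-manifolds; the directory is that of the definition served.
-/
open scoped Topology
open Function Set Filter

namespace Literature.Topology.FourManifolds

namespace Foliation

variable {B : Type*} [TopologicalSpace B] {M : Type*} [TopologicalSpace M]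

/-! ## Plaques -/

/-- The **plaque** of the flow box `e` at height `t`: the points of `e.source` whose transverse
coordinate is `t`. For a flow box of a foliation (onto `B × ℝ`) this is `e.symm '' (B × {t})`
(`plaque_eq_range`). (Hector–Hirsch A, Ch. I 2.2.2, Ch. II 2.1.6 (iii).) [folklore] -/
def plaque (e : OpenPartialHomeomorph M (B × ℝ)) (t : ℝ) : Set M :=
  {y | y ∈ e.source ∧ (e y).2 = t}

variable {e e' : OpenPartialHomeomorph M (B × ℝ)} {t : ℝ} {x y z : M}

/-- Unfolding lemma for `plaque`. [folklore] -/
theorem mem_plaque_iff : y ∈ plaque e t ↔ y ∈ e.source ∧ (e y).2 = t := Iff.rfl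

/-- A plaque of `e` lies in the source of `e`. [folklore] -/
theorem plaque_subset_source : plaque e t ⊆ e.source := fun _ h ↦ h.1

/-- Every point of a flow box lies on the plaque at its own height. [folklore] -/
theorem mem_plaque_self (hy : y ∈ e.source) : y ∈ plaque e (e y).2 := ⟨hy, rfl⟩

/-- Two plaques of one flow box that meet are equal (they have the same height). [folklore] -/
theorem plaque_eq_of_mem (hy : y ∈ plaque e t) : plaque e (e y).2 = plaque e t := by
  rw [hy.2]

variable (F : Foliation B M)

/-- The inverse of a flow box of a foliation is continuous on the whole box `B × ℝ` (flow boxes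
are onto). [folklore] -/
theorem continuous_symm_of_mem (he : e ∈ F.atlas) : Continuous e.symm := by
  rw [← continuousOn_univ, ← F.target_eq e he]
  exact e.continuousOn_symm

/-- In a flow box of a foliation, `e.symm (b, t)` lies on the plaque at height `t`. [folklore] -/
theorem symm_mem_plaque (he : e ∈ F.atlas) (b : B) (t : ℝ) : e.symm (b, t) ∈ plaque e t := by
  have ht : (b, t) ∈ e.target := by
    rw [F.target_eq e he]
    exact mem_univ _
  exact ⟨e.map_target ht, by rw [e.right_inv ht]⟩

/-- A plaque of a flow box of a foliation is the image of `B × {t}`: the range of the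
horizontal section `b ↦ e.symm (b, t)`. [folklore] -/
theorem plaque_eq_range (he : e ∈ F.atlas) (t : ℝ) :
    plaque e t = range (fun b : B ↦ e.symm (b, t)) := by
  ext y
  constructor
  · rintro ⟨hy, hyt⟩
    refine ⟨(e y).1, ?_⟩
    simp only
    rw [← hyt, Prod.mk.eta, e.left_inv hy]
  · rintro ⟨b, rfl⟩
    exact F.symm_mem_plaque he b t

/-- Plaques are preconnected when the leaf model `B` is. [folklore] -/
theorem isPreconnected_plaque [PreconnectedSpace B] (he : e ∈ F.atlas) (t : ℝ) :
    IsPreconnected (plaque e t) := by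
  rw [F.plaque_eq_range he t]
  exact isPreconnected_range
    ((F.continuous_symm_of_mem he).comp (continuous_id.prodMk continuous_const))

/-- Plaques are connected when the leaf model `B` is (Hector–Hirsch A, Ch. II 2.1.6 (iii):
plaques are the components of the fibres of the distinguished maps). [folklore] -/
theorem isConnected_plaque [ConnectedSpace B] (he : e ∈ F.atlas) (t : ℝ) :
    IsConnected (plaque e t) := by
  rw [F.plaque_eq_range he t]
  exact isConnected_range
    ((F.continuous_symm_of_mem he).comp (continuous_id.prodMk continuous_const))

/-! ## Leaves are saturated by plaques; leaf heights -/

/-- Two points of one plaque lie on a common plaque (`SamePlaque`). [folklore] -/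
theorem samePlaque_of_mem_plaque (he : e ∈ F.atlas) (hy : y ∈ plaque e t) (hz : z ∈ plaque e t) :
    F.SamePlaque y z :=
  ⟨e, he, hy.1, hz.1, hy.2.trans hz.2.symm⟩

/-- **Leaves are saturated by plaques**: a plaque meeting the leaf `F.leaf x` lies in it.
[folklore] -/
theorem plaque_subset_leaf_of_mem (he : e ∈ F.atlas) (hy : y ∈ F.leaf x) (hyt : y ∈ plaque e t) :
    plaque e t ⊆ F.leaf x := fun z hz ↦ by
  rw [← leaf_eq_of_mem hy]
  exact (F.samePlaque_of_mem_plaque he hyt hz).mem_leaf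

/-- The **heights of a leaf in a flow box**: `F.leafHeights e x` is the set `H_e(L)` of
transverse coordinates `t` such that the leaf `L = F.leaf x` meets (equivalently, by
saturation, contains) the plaque of `e` at height `t`. [folklore] -/
def leafHeights (e : OpenPartialHomeomorph M (B × ℝ)) (x : M) : Set ℝ :=
  {t | ∃ y ∈ F.leaf x, y ∈ plaque e t}

/-- Unfolding lemma for `leafHeights`. [folklore] -/
theorem mem_leafHeights_iff : t ∈ F.leafHeights e x ↔ ∃ y ∈ F.leaf x, y ∈ plaque e t := Iff.rfl

/-- The height of a point of the leaf is a leaf height. [folklore] -/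
theorem height_mem_leafHeights (hy : y ∈ F.leaf x) (hye : y ∈ e.source) :
    (e y).2 ∈ F.leafHeights e x :=
  ⟨y, hy, mem_plaque_self hye⟩

/-- The leaf heights of a flow box around `x` are nonempty. [folklore] -/
theorem leafHeights_nonempty (hxe : x ∈ e.source) : (F.leafHeights e x).Nonempty :=
  ⟨_, F.height_mem_leafHeights (F.mem_leaf_self x) hxe⟩

/-- The plaque at a leaf height lies in the leaf. [folklore] -/
theorem plaque_subset_leaf (he : e ∈ F.atlas) (ht : t ∈ F.leafHeights e x) :
    plaque e t ⊆ F.leaf x := by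
  obtain ⟨y, hy, hyt⟩ := ht
  exact F.plaque_subset_leaf_of_mem he hy hyt

/-- **Within a flow box, membership in a leaf is decided by the height.** [folklore] -/
theorem mem_leaf_iff_of_mem_source (he : e ∈ F.atlas) (hz : z ∈ e.source) :
    z ∈ F.leaf x ↔ (e z).2 ∈ F.leafHeights e x :=
  ⟨fun h ↦ F.height_mem_leafHeights h hz, fun h ↦ F.plaque_subset_leaf he h (mem_plaque_self hz)⟩

/-- The trace of a leaf on a flow box is the union of the plaques at the leaf heights:
`L ∩ e.source = e.source ∩ height⁻¹' H_e(L)`. [folklore] -/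
theorem leaf_inter_source (he : e ∈ F.atlas) :
    F.leaf x ∩ e.source = e.source ∩ (fun z ↦ (e z).2) ⁻¹' F.leafHeights e x := by
  ext z
  constructor
  · rintro ⟨hz, hze⟩
    exact ⟨hze, (F.mem_leaf_iff_of_mem_source he hze).1 hz⟩
  · rintro ⟨hze, hz⟩
    exact ⟨(F.mem_leaf_iff_of_mem_source he hze).2 hz, hze⟩

/-- The leaf heights are the heights of the points of `L ∩ e.source`. [folklore] -/
theorem leafHeights_eq_image :
    F.leafHeights e x = (fun z ↦ (e z).2) '' (F.leaf x ∩ e.source) := by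
  ext t
  constructor
  · rintro ⟨y, hy, hye, rfl⟩
    exact ⟨y, ⟨hy, hye⟩, rfl⟩
  · rintro ⟨y, ⟨hy, hye⟩, rfl⟩
    exact ⟨y, hy, hye, rfl⟩

/-- The leaf heights in a flow box of a foliation are the preimage of the leaf under any
vertical `t ↦ e.symm (b, t)` of the box. [folklore] -/
theorem leafHeights_eq_preimage (he : e ∈ F.atlas) (b : B) :
    F.leafHeights e x = (fun t ↦ e.symm (b, t)) ⁻¹' F.leaf x := by
  ext t
  have hp := F.symm_mem_plaque he b t
  exact ⟨fun ht ↦ F.plaque_subset_leaf he ht hp, fun h ↦ ⟨_, h, hp⟩⟩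

/-- **A closed leaf has closed height sets** in every flow box of the foliation (for a
nonempty leaf model). [folklore] -/
theorem isClosed_leafHeights [Nonempty B] (he : e ∈ F.atlas) (hL : IsClosed (F.leaf x)) :
    IsClosed (F.leafHeights e x) := by
  obtain ⟨b⟩ := ‹Nonempty B›
  rw [F.leafHeights_eq_preimage he b]
  exact hL.preimage ((F.continuous_symm_of_mem he).comp (continuous_const.prodMk continuous_id))

/-! ## Transverse coordinates are locally constant along plaques -/

/-- **The transverse coordinate of one flow box is locally constant along the plaques of
another**: this is the compatibility condition of the foliated atlas (`Foliation.locally_plaque`: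
near each point of an overlap, equal `e`-heights give equal `e'`-heights) read on the plaque
`plaque e t` (Hector–Hirsch A, Ch. I 2.2.1, Ch. II 2.1.1: the changes of coordinates have the
form `(x, t) ↦ (α(x, t), γ(t))`). [folklore] -/
theorem exists_nhds_height_eq_of_mem_plaque (he : e ∈ F.atlas) (he' : e' ∈ F.atlas)
    (hy : y ∈ plaque e t) (hy' : y ∈ e'.source) :
    ∃ U ∈ 𝓝 y, ∀ z ∈ U, z ∈ plaque e t → z ∈ e'.source → (e' z).2 = (e' y).2 := by
  obtain ⟨U, hU, h⟩ := F.locally_plaque e he e' he' y ⟨hy.1, hy'⟩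
  exact ⟨U, hU, fun z hzU hz hz' ↦
    h z ⟨hzU, hz.1, hz'⟩ y ⟨mem_of_mem_nhds hU, hy.1, hy'⟩ (hz.2.trans hy.2.symm)⟩

/-- Filter form of `exists_nhds_height_eq_of_mem_plaque`: eventually near a point `y` of
`plaque e t ∩ e'.source`, the points of that set have the `e'`-height of `y`. [folklore] -/
theorem eventually_height_eq_of_mem_plaque (he : e ∈ F.atlas) (he' : e' ∈ F.atlas)
    (hy : y ∈ plaque e t) (hy' : y ∈ e'.source) :
    ∀ᶠ z in 𝓝 y, z ∈ plaque e t → z ∈ e'.source → (e' z).2 = (e' y).2 := by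
  obtain ⟨U, hU, h⟩ := F.exists_nhds_height_eq_of_mem_plaque he he' hy hy'
  exact mem_of_superset hU fun z hz ↦ h z hz

/-- **The transverse coordinate of `e'` is constant on every preconnected subset of
`plaque e t ∩ e'.source`** (a locally constant function on a preconnected set is constant).
In particular it is constant on the connected components of `plaque e t ∩ e'.source`: each
lies in a single plaque of `e'` (Hector–Hirsch A, Ch. II 2.1.6 (iii): "the intersection of two
plaques is a union of plaques"). [folklore] -/
theorem height_eq_of_isPreconnected (he : e ∈ F.atlas) (he' : e' ∈ F.atlas) {C : Set M}
    (hC : IsPreconnected C) (hCt : C ⊆ plaque e t) (hC' : C ⊆ e'.source) (hy : y ∈ C)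
    (hz : z ∈ C) : (e' y).2 = (e' z).2 := by
  have key : IsLocallyConstant (fun w : C ↦ (e' (w : M)).2) := by
    refine (IsLocallyConstant.iff_eventually_eq _).2 fun w ↦ ?_
    have hw := F.eventually_height_eq_of_mem_plaque he he' (hCt w.2) (hC' w.2)
    have hc : ContinuousAt (Subtype.val : C → M) w := continuous_subtype_val.continuousAt
    filter_upwards [hc.eventually hw] with v hv
    exact hv (hCt v.2) (hC' v.2)
  haveI := isPreconnected_iff_preconnectedSpace.1 hC
  exact key.apply_eq_of_preconnectedSpace ⟨y, hy⟩ ⟨z, hz⟩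

/-! ## Accumulation of a leaf on itself is transported along the leaf -/

/-- **Transport of accumulation across one plaque.** Let `y` lie on the plaque of `e` at height
`t` and in the flow box `e'`. If the heights `H_e(L)` of the leaf `L = F.leaf x` accumulate at
`t`, then the heights `H_{e'}(L)` accumulate at the `e'`-height of `y`: plaques of `L` at
heights `tₙ → t`, `tₙ ≠ t`, cross the vertical of `e` through `y` at points `zₙ → y` of `L`,
whose `e'`-heights converge to that of `y` and differ from it (equal `e'`-heights near `y` would
give equal `e`-heights, by the compatibility of the atlas). (Hector–Hirsch A, Ch. I 4.1.1: the
foliation defines local homeomorphisms between transversals along a curve in a leaf, mapping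
`c₀ ∩ L` into `c₁ ∩ L`.) [folklore] -/
theorem accPt_leafHeights_of_mem_plaque (he : e ∈ F.atlas) (he' : e' ∈ F.atlas)
    (hy : y ∈ plaque e t) (hy' : y ∈ e'.source) (ht : AccPt t (𝓟 (F.leafHeights e x))) :
    AccPt (e' y).2 (𝓟 (F.leafHeights e' x)) := by
  rw [accPt_iff_nhds] at ht ⊢
  intro V hV
  -- the vertical of the box `e` through `y`, and the `e'`-height along it
  set φ : ℝ → M := fun s ↦ e.symm ((e y).1, s) with hφ
  set g : ℝ → ℝ := fun s ↦ (e' (φ s)).2 with hg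
  have hφc : Continuous φ :=
    (F.continuous_symm_of_mem he).comp (continuous_const.prodMk continuous_id)
  have hφt : φ t = y := by
    simp only [hφ]
    rw [← hy.2, Prod.mk.eta, e.left_inv hy.1]
  have hgt : g t = (e' y).2 := by
    simp only [hg]
    rw [hφt]
  have hgc : ContinuousAt g t :=
    (continuous_snd.continuousAt.comp (e'.continuousAt (by rwa [hφt]))).comp hφc.continuousAt
  -- compatibility of the atlas near `y`, for the pair `(e', e)`
  obtain ⟨U, hU, hUe⟩ := F.locally_plaque e' he' e he y ⟨hy', hy.1⟩
  -- parameters `s` near `t` give points of `U ∩ e'.source` with `e'`-height in `V`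
  have h₁ : ∀ᶠ s in 𝓝 t, φ s ∈ U ∩ e'.source :=
    hφc.continuousAt.preimage_mem_nhds
      (by rw [hφt]; exact inter_mem hU (e'.open_source.mem_nhds hy'))
  have h₂ : ∀ᶠ s in 𝓝 t, g s ∈ V := hgc.preimage_mem_nhds (by rwa [hgt])
  obtain ⟨s, ⟨⟨hsU, hsV⟩, hsH⟩, hst⟩ := ht _ (h₁.and h₂)
  -- the point `φ s` of the leaf has `e'`-height in `V ∩ H_{e'}(L)`, different from that of `y`
  have hsp : φ s ∈ plaque e s := F.symm_mem_plaque he (e y).1 s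
  have hsL : φ s ∈ F.leaf x := F.plaque_subset_leaf he hsH hsp
  refine ⟨g s, ⟨hsV, F.height_mem_leafHeights hsL hsU.2⟩, fun hgs ↦ hst ?_⟩
  have key : (e (φ s)).2 = (e y).2 :=
    hUe (φ s) ⟨hsU.1, hsU.2, hsp.1⟩ y ⟨mem_of_mem_nhds hU, hy', hy.1⟩ hgs
  rw [hsp.2, hy.2] at key
  exact key

/-- **Self-accumulation is all-or-nothing along a leaf.** For two points `y₁, y₂` of the leaf
`L = F.leaf x` and flow boxes `e₁ ∋ y₁`, `e₂ ∋ y₂` of the foliation, the heights `H_{e₁}(L)`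
accumulate at the height of `y₁` iff the heights `H_{e₂}(L)` accumulate at the height of `y₂`
(transport across each plaque of a chain joining `y₁` to `y₂`). [folklore] -/
theorem accPt_leafHeights_iff_of_mem_leaf {e₁ e₂ : OpenPartialHomeomorph M (B × ℝ)}
    (he₁ : e₁ ∈ F.atlas) (he₂ : e₂ ∈ F.atlas) {y₁ y₂ : M} (hy₁ : y₁ ∈ F.leaf x)
    (hy₂ : y₂ ∈ F.leaf x) (h₁ : y₁ ∈ e₁.source) (h₂ : y₂ ∈ e₂.source) :
    AccPt (e₁ y₁).2 (𝓟 (F.leafHeights e₁ x)) ↔ AccPt (e₂ y₂).2 (𝓟 (F.leafHeights e₂ x)) := by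
  -- `P y`: the heights accumulate at `y` in every flow box around `y`
  let P : M → Prop := fun y ↦
    ∀ e ∈ F.atlas, y ∈ e.source → AccPt (e y).2 (𝓟 (F.leafHeights e x))
  -- one flow box suffices
  have hP : ∀ {e : OpenPartialHomeomorph M (B × ℝ)} {y : M}, e ∈ F.atlas → y ∈ e.source →
      AccPt (e y).2 (𝓟 (F.leafHeights e x)) → P y := fun he hye h e' he' hye' ↦
    F.accPt_leafHeights_of_mem_plaque he he' (mem_plaque_self hye) hye' h
  -- `P` is invariant along chains of plaques
  have hPP : ∀ {a b : M}, Relation.EqvGen F.SamePlaque a b → (P a ↔ P b) := by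
    intro a b hab
    induction hab with
    | rel a b hab =>
      obtain ⟨e, he, hae, hbe, habe⟩ := hab
      constructor
      · intro ha
        exact hP he hbe (F.accPt_leafHeights_of_mem_plaque he he ⟨hbe, habe.symm⟩ hbe
          (ha e he hae))
      · intro hb
        exact hP he hae (F.accPt_leafHeights_of_mem_plaque he he ⟨hae, habe⟩ hae
          (hb e he hbe))
    | refl a => exact Iff.rfl
    | symm a b _ ih => exact ih.symm
    | trans a b c _ _ ih₁ ih₂ => exact ih₁.trans ih₂
  have h12 : Relation.EqvGen F.SamePlaque y₁ y₂ :=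
    Relation.EqvGen.trans _ _ _ (Relation.EqvGen.symm _ _ hy₁) hy₂
  constructor
  · intro h
    exact (hPP h12).1 (hP he₁ h₁ h) e₂ he₂ h₂
  · intro h
    exact (hPP h12).2 (hP he₂ h₂ h) e₁ he₁ h₁

/-! ## Where the heights do not accumulate, the leaf is locally one plaque -/

/-- **Locally a single plaque.** If the heights `H_e(L)` of the leaf `L = F.leaf x` do not
accumulate at the height of a point `y ∈ L` of the flow box `e`, then in a thin enough slab of
`e` around the plaque of `y` the leaf consists of that plaque alone: there is `δ > 0` such that
a point `z` of `e.source` with `|h(z) - h(y)| < δ` lies on `L` iff `h(z) = h(y)`. [folklore] -/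
theorem exists_mem_leaf_iff_of_not_accPt (he : e ∈ F.atlas) (hy : y ∈ F.leaf x) (hye : y ∈ e.source)
    (h : ¬ AccPt (e y).2 (𝓟 (F.leafHeights e x))) :
    ∃ δ > (0 : ℝ), ∀ z ∈ e.source, |(e z).2 - (e y).2| < δ →
      (z ∈ F.leaf x ↔ (e z).2 = (e y).2) := by
  rw [accPt_iff_nhds] at h
  push Not at h
  obtain ⟨U, hU, hU'⟩ := h
  obtain ⟨δ, hδ, hball⟩ := Metric.mem_nhds_iff.1 hU
  refine ⟨δ, hδ, fun z hze hz ↦ ⟨fun hzL ↦ ?_, fun hzy ↦ ?_⟩⟩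
  · exact hU' _ ⟨hball (by rwa [Metric.mem_ball, Real.dist_eq]), F.height_mem_leafHeights hzL hze⟩
  · exact F.plaque_subset_leaf_of_mem he hy (mem_plaque_self hye) ⟨hze, hzy⟩

end Foliation

end Literature.Topology.FourManifolds
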